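import Summits.BirchSwinnertonDyer.BirchSwinnertonDyer.Theses.PrintCf2RubinValueTwo
import Summits.BirchSwinnertonDyer.BirchSwinnertonDyer.Theorems.PrintCf2RubinValueTwoSplitBadOfIngredientsV15FrameD
import Summits.BirchSwinnertonDyer.BirchSwinnertonDyer.Theorems.PrintCf2RubinValueTwoRestrictedMainConjV12OfDGalOfXRegularJZero
import Summits.BirchSwinnertonDyer.BirchSwinnertonDyer.Theorems.PrintCf2SplitBadTwoXRegularPinnedOrderTwo
import Summits.BirchSwinnertonDyer.BirchSwinnertonDyer.Theorems.PrintCf2RubinValueTwoUnrSelmerInvariantsFinite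
import Summits.BirchSwinnertonDyer.BirchSwinnertonDyer.Theorems.PrintCf2SplitBadTwoFrameSupplyV10ClassField
import Literature.NumberTheory.EllipticCurves.DeShalit1987.KatzMeasureJZero
import HarnessLib

/-!
# Road α, CLASS-RESTRICTED, READ ON THE LINE `j = 0`: the V16 glue, PART 1 (join + defect key) — (D-Gal) ∧ (REG₂) ∧ S3c ∧ S3d ⟹ the S3 LAW₀;
# GZK ∧ Deuring ∧ dictionary ∧ S3a-CLASS₀ ∧ S2′-v12 ∧ S3-LAW₀ ⟹ (DK)   (crux `PrintCf2.SplitBadTwoRankOneOfFacts`, stmt-BirchSwinnertonDyer-20368)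


Cell `bsd-print-cf2`, LEAD seat `bsd-line-cf2-p1` g19 (prover-bsd-line-cf2-p1-g19-0), `--supports stmt-BirchSwinnertonDyer-20368` (helper). = the V15 glue p726930
`RubinValueTwoIngredientsV15.splitBadOfIngredientsV15_of_class` with ONE change of content (director-bsd 2026-08-30T02:44:19Z OPTION 1 «build the j = 0
twin»; planner g22 rev 29/30): the frame's two-variable measure `G₂` is a `j = 0` KATZ MEASURE — every occurrence of the binder
`IsKatzMeasure₂ ι v v̄ S κ₁ κ₂ γ₁⁻¹ γ₂⁻¹ θ_K⁻¹ Ω δ Ω₂ G₂` reads `IsKatzMeasure₂₀ …` (p758994 `Literature/…/DeShalit1987/KatzMeasureJZero.lean`): in the S3a slot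
(`h3a` = route-C twin `TwoVariableMainConjAtSplitTwoQuadDAClassJZero`, the rev-29 aside; WEAKER than `TwoVariableMainConjAtSplitTwoQuadDAClass`), in the value law
(`h2` = twin 24034′ = S2′-v12, LEAD g19 skeleton v14.7 text), in the S3 law (the join `ellipticUnitDescent_two_v16_of_items` over LEAD g19's S3b′₀ twin
`RubinValueTwoV12XReg.restrictedMainConj_two_v12_of_DGal_of_XRegular₀` — S3b′ never used the interpolation property) and in the key `defectKey_of_laws_v16_of_items`.
FOR THE PLANNER (rev 30 `closes` re-cut): `SplitBadOfIngredientsV16 := PrintsRubinTwoV13 → PrintsAnchorTwo → TwoVariableMainConjAtSplitTwoQuadDAClassJZero →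
GoodTwistDictionaryAtTwo → RubinValueFormulaAtTwoV12 → XRegularAtTwo → RestrictedSelmerControlAtTwo → StrictDefectAtVbarTwo → PrintCf2.SplitBadTwoRankOneOfFacts`
(EIGHT binders — no `RestrictedMainConjGVAtTwo` slot: its `j = 0` twin is a theorem and is re-derived inside) closes by
`fun h0 hP h3a hD h2 hX h3c h3d ↦ splitBadOfIngredientsV16_of_class h0 hP h3a hD h2 hX h3c h3d`; and `closes` becomes
`PrintCf2.closes hRes.1 hRes.2 (hG16 h0 hA (hH hμ hC) hD h2 hX h3c h3d) hF` with `hμ : KatzDistributionsAtTwoJZeroClassOne`, `hC : MainConjClauseAtSplitTwoQuadDAClassJZero`,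
`hH : TwoVariableMainConjAtSplitTwoQuadDAClassJZeroOfHalves` (rev-29 glue, planner-proved), `h2 : RubinValueFormulaAtTwoV12` (text of `h2` below).
HONEST FRAMING: pure re-threading; none of the eight ingredients is discharged here; no summit statement is proved by this seat; BSD is not proved by any of this.
References: [Rubin1991] §11 Thm. 11.1 (shape); [Rubin1992] Cor. 10.2–10.3 (shape); [LiTianYanZhu2025] Thm. 7.2; [deShalit1987] II.4.17 (54), II Thm. 4.14 at j = 0.
-/

set_option autoImplicit false
set_option linter.dupNamespace false

noncomputable section

open scoped Classical
open NumberField IsDedekindDomain Field WeierstrassCurve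
open Literature.NumberTheory.GaloisRepresentations Literature.NumberTheory.EllipticCurves
open Literature.NumberTheory.EllipticCurves.Rank1Residual
open Literature.NumberTheory.EllipticCurves.DeShalit1987
open Summit.BirchSwinnertonDyer.BirchSwinnertonDyer.Theses.PrintCf2
open Summit.BirchSwinnertonDyer.BirchSwinnertonDyer.Theses.PrintCf2RubinValueTwo
open Summit.BirchSwinnertonDyer.BirchSwinnertonDyer.Theorems

namespace Summit.BirchSwinnertonDyer.BirchSwinnertonDyer.Theorems.PrintCf2.RubinValueTwoIngredientsV16

/-- **JOIN READ AT `j = 0` (transcribed from the LEAD skeleton v14.7 `ellipticUnitDescent_two_v10_of_split`; = p709855's V14 join with the frame binder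
`IsKatzMeasure₂ ↦ IsKatzMeasure₂₀` and S3b′ := LEAD g19's twin `restrictedMainConj_two_v12_of_DGal_of_XRegular₀`): (D-Gal) ∧ (REG₂) ∧ S3c ∧ S3d ⟹ the S3 LAW₀ in v10
currency**, `e_B := 2·e_C + 2·e_δ + e_M`: on a frame, S3b′-v13 (a THEOREM: p698841 ∘ p702770 ∘ p690299, fed the print (D-Gal) and the crux `XRegularAtTwo`
= (REG₂) by name) yields the pinned summand, the Greenberg–Vatsal datum on the line `κ₂` with `(H′)`, `H′(0) ≠ 0`,
`ord₂ H′(0) = n′` and the value clause; S3d (`StrictDefectAtVbarTwo`) turns it into Agboola's strict datum with `HasCharValuationAt n`,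
`n′ = n + e_δ`; S3c (`RestrictedSelmerControlAtTwo`) reads `n`; set `m := 2n′ + e_M`. [cite: Agboola2007, Thm. 2]
[cite: Rubin1992, Cor. 10.3 (shape)] -/
theorem ellipticUnitDescent_two_v16_of_items (hD : Deuring_galoisAction_cmPrimaryTorsion_split)
    (hX : XRegularAtTwo) (h3c : RestrictedSelmerControlAtTwo) (h3d : StrictDefectAtVbarTwo) :
    ∃ eB : ℤ → ℤ → ℤ,
    ∀ (d : ℤ), d ≠ 0 → Squarefree d → d % 4 ≠ 1 →
    ∀ (W : WeierstrassCurve ℚ) [W.IsElliptic] [W.IsGloballyMinimal] (C : VariableChange ℚ),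
      C • W = cm7.quadraticTwist (d : ℚ) → W.analyticRank = 1 →
      Finite W.sha →
    ∀ (K : Type) [Field K] [NumberField K], IsImaginaryQuadratic K →
    ∀ (v vbar : HeightOneSpectrum (𝓞 K)),
      ((2 : ℕ) : 𝓞 K) ∈ v.asIdeal → ((2 : ℕ) : 𝓞 K) ∈ vbar.asIdeal → vbar ≠ v →
    ∀ (ι : PadicAlgCl 2 ≃+* ℂ),
      (∀ (w : InfinitePlace K) (k : 𝓞 K), k ∈ v.asIdeal ↔ ‖ι.symm (w.embedding (k : K))‖ < 1) →
    ∀ (c : K ≃ₐ[ℚ] K), c ≠ 1 →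
    ∀ (ψ : HeckeCharacter K), ψ.HasInfinityType (fun _ ↦ 1) (fun _ ↦ 0) →
      (∀ s : ℂ, 3 / 2 < s.re → heckeLFunction ψ s = W.LSeries s) →
    ∀ (κ₁ κ₂ : ZpExtension K 2) (γ₁ γ₂ : absoluteGaloisGroup K), ZpExtension.IsTopGeneratorPair κ₁ κ₂ γ₁ γ₂ →
      κ₂.IsUnramifiedOutside vbar →
    ∀ (θ : FramedGaloisRep K (padicCoeffIntegers (∅ : Set (PadicAlgCl 2))) 1)
      (θK ρ : HeckeCharacter K) (r : FramedGaloisRep K (PadicAlgCl 2) 1),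
      (∀ σ : absoluteGaloisGroup K, θ σ ^ 2 = 1) → KellerYin2024.IsHeckeCharOf ι θ θK →
      θK * θK = 1 → IsPAdicAvatarOf ι ρ r → FactorsThroughPair κ₁ κ₂ r →
      θK⁻¹ * ρ = (HeckeCharacter.galConj c ψ)⁻¹ →
    ∀ (Sθ : Finset (HeightOneSpectrum (𝓞 K))), v ∉ Sθ → vbar ∉ Sθ →
      (∀ w ∈ Sθ, ¬ θK.IsUnramifiedAt w) →
      (∀ w : HeightOneSpectrum (𝓞 K), w ∉ Sθ → w ≠ v → w ≠ vbar → θK.IsUnramifiedAt w) →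
    ∀ (Ω δ : ℂ) (Ωp : (unrIntegers 2)ˣ) (G₂ : PowerSeries (PowerSeries (PadicComplexInt 2))),
      Ω ≠ 0 → (δ ^ 2 = (NumberField.discr K : ℂ) ∨ δ ^ 2 = -(NumberField.discr K : ℂ)) →
      IsKatzMeasure₂₀ ι v vbar Sθ κ₁ κ₂ γ₁⁻¹ γ₂⁻¹ θK⁻¹ Ω δ ((Ωp : unrIntegers 2) : ℂ_[2]) G₂ →
      -- v11: S3a's main-conjecture clause FOR THIS `G₂` (the frame's own measure; kills the period-rigidity exposure (R))
      (∀ D₂ : DualData₂ κ₁ κ₂ (KellerYin2024.charModule (∅ : Set (PadicAlgCl 2)) θ) vbar γ₁ γ₂,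
        Module.Finite (IwasawaAlgebra₂ 2) D₂.X ∧ Module.IsTorsion (IwasawaAlgebra₂ 2) D₂.X ∧
        ∀ (J : ℤ_[2] →+* PadicComplexInt 2),
          (∀ x : ℤ_[2], ((J x : PadicComplexInt 2) : ℂ_[2]) = ((x : ℚ_[2]) : ℂ_[2])) →
          (Module.charIdeal (IwasawaAlgebra₂ 2) D₂.X).map
              (PowerSeries.map (PowerSeries.map J)) = Ideal.span {G₂}) →
    ∀ (P : W.toAffine.Point) (c₀ : ℕ) (ℓ : ℤ),
      ¬ IsOfFinAddOrder P →
      (∀ R : W.toAffine.Point, ∃ (k : ℤ) (T : W.toAffine.Point), IsOfFinAddOrder T ∧ R = k • P + T) →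
      c₀ ≠ 0 → (W.baseChange ℚ_[2]).IsInReductionKernel (c₀ • W.toPadicPoint 2 P) →
      ‖(W.baseChange ℚ_[2]).padicLogPoint (c₀ • W.toPadicPoint 2 P) / (c₀ : ℚ_[2])‖ = (2 : ℝ) ^ (-ℓ) →
    ∃ m : ℤ, (∀ val : ℂ_[2],
        IntSeries.HasValueAt₂ G₂ (avatarValueAt r γ₁⁻¹ - 1) (avatarValueAt r γ₂⁻¹ - 1) val →
        ‖val‖ = (2 : ℝ) ^ (-(m : ℝ) / 2)) ∧
      m = 2 * ((padicValNat 2 (Nat.card (AddCommGroup.primaryComponent W.sha 2)) : ℤ)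
            + (padicValNat 2 W.tamagawaProduct : ℤ)
            - 2 * (padicValNat 2 W.torsionOrder : ℤ) + 2 * ℓ) + eB (d % 2) ((d / (2 - d % 2)) % 8) := by
  obtain ⟨eM, hM⟩ := PrintCf2.RubinValueTwoV12XReg.restrictedMainConj_two_v12_of_DGal_of_XRegular₀ hD
    PrintCf2.UnrInvariants.finite_endInvariants_conjUnr_of_frame (PrintCf2.XRegPinned.xRegular_pinned_of_xRegular_char_two hD hX)
  obtain ⟨eδ, hδ⟩ := h3d
  obtain ⟨eC, hC⟩ := h3c
  refine ⟨fun k₁ k₂ ↦ 2 * eC k₁ k₂ + 2 * eδ k₁ k₂ + eM k₁ k₂, ?_⟩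
  intro d hd0 hsq hd4 W _ _ C hC' hr hsha K _ _ hK v vbar hv hvbar hne ι hι c hc ψ hψ hL κ₁ κ₂ γ₁ γ₂ hpair hκ₂ θ θK ρ r hθ2 hθθK hθK
    hρr hrpair hρ Sθ hvS hvbarS hSram hSunr Ω δ Ωp G₂ hΩ hδ' hG₂ hMC P c₀ ℓ hP hgen hc₀ hker hlog
  obtain ⟨π, hπ, r₀, hr₀, hpin, Dnr, n', H', hDf', hDt', hDch', hH0', hHn', hval⟩ :=
    hM d hd0 hsq hd4 W C hC' hr hsha K hK v vbar hv hvbar hne ι hι c hc ψ hψ hL κ₁ κ₂ γ₁ γ₂ hpair hκ₂ θ θK ρ r hθ2 hθθK hθK hρr hrpair hρ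
      Sθ hvS hvbarS hSram hSunr Ω δ Ωp G₂ hΩ hδ' hG₂ hMC P c₀ ℓ hP hgen hc₀ hker hlog
  obtain ⟨D, n, hDf, hDn, hδn⟩ := hδ d hd0 hsq hd4 W C hC' hr hsha K hK v vbar hv hvbar hne π hπ r₀ hr₀ hpin κ₂ hκ₂ γ₂ hpair.2.2.2
    P c₀ ℓ hP hgen hc₀ hker hlog Dnr n' H' hDf' hDt' hDch' hH0' hHn'
  have hn := hC d hd0 hsq hd4 W C hC' hr K hK v vbar hv hvbar hne π hπ r₀ hr₀ hpin κ₂ hκ₂ γ₂ hpair.2.2.2 D n hDf hDn P c₀ ℓ hP hgen hc₀ hker hlog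
  refine ⟨2 * (n' : ℤ) + eM (d % 2) ((d / (2 - d % 2)) % 8), hval, ?_⟩
  rw [hδn, hn]
  ring

/-- **(DK) v16 from GZK, Deuring, the DICTIONARY item's text, S3a-CLASS₀'s text (`j = 0` Katz measure), S2′-v12 and the S3 LAW₀** — the LEAD skeleton v14.7's
`defectKey_of_laws_v16` with the supply `frameSupply_two_v15d_of_dict`; body VERBATIM p726930's `defectKey_of_laws_v15_of_items` except that the three occurrences
of the frame binder `IsKatzMeasure₂ …` read `IsKatzMeasure₂₀ …` (the key reads `G₂` through `HasValueAt₂.unique` only). [cite: Rubin1992, Cor. 10.2 and Cor. 10.3 (shape)] [cite: deShalit1987, II.4.17 (54)] -/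
theorem defectKey_of_laws_v16_of_items
    (hGZK : rank_eq_analyticRank_of_analyticRank_le_one) (hdeu : Deuring_exists_heckeCharacter_of_maximalCM_withGenerators)
    (hdictAll :
      Deuring_exists_heckeCharacter_of_maximalCM_withGenerators →
      ∀ (d : ℤ), d ≠ 0 → Squarefree d → d % 4 ≠ 1 →
      ∀ (W : WeierstrassCurve ℚ) [W.IsElliptic] [W.IsGloballyMinimal] (C : VariableChange ℚ),
        C • W = cm7.quadraticTwist (d : ℚ) → W.analyticRank = 1 →
      ∀ (K : Type) [Field K] [NumberField K], IsImaginaryQuadratic K → ¬ 2 ∣ NumberField.classNumber K →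
        NumberField.discr K = -7 →
      ∀ (c : K ≃ₐ[ℚ] K), c ≠ 1 →
      ∀ (ψ : HeckeCharacter K), ψ.HasInfinityType (fun _ ↦ 1) (fun _ ↦ 0) → IsHeckeConjEquivariant c ψ →
        (∀ s : ℂ, 3 / 2 < s.re → heckeLFunction ψ s = W.LSeries s) →
      ∃ (v vbar : HeightOneSpectrum (𝓞 K)),
        ((2 : ℕ) : 𝓞 K) ∈ v.asIdeal ∧ ((2 : ℕ) : 𝓞 K) ∈ vbar.asIdeal ∧ vbar ≠ v ∧
      ∀ (ι : PadicAlgCl 2 ≃+* ℂ),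
        (∀ (w : InfinitePlace K) (k : 𝓞 K), k ∈ v.asIdeal ↔ ‖ι.symm (w.embedding (k : K))‖ < 1) →
      ∀ (κ₁ κ₂ : ZpExtension K 2) (γ₁ γ₂ : absoluteGaloisGroup K),
        ZpExtension.IsTopGeneratorPair κ₁ κ₂ γ₁ γ₂ → κ₂.IsUnramifiedOutside vbar →
        κ₁.IsUnramifiedOutside v → γ₁ ∈ GreenbergSelmer.inertia v → γ₂ ∈ GreenbergSelmer.inertia vbar →
      ∀ (θ : FramedGaloisRep K (padicCoeffIntegers (∅ : Set (PadicAlgCl 2))) 1)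
        (θK ρ : HeckeCharacter K) (r : FramedGaloisRep K (PadicAlgCl 2) 1),
        (∀ σ : absoluteGaloisGroup K, θ σ ^ 2 = 1) → KellerYin2024.IsHeckeCharOf ι θ θK →
        θK * θK = 1 → IsPAdicAvatarOf ι ρ r → FactorsThroughPair κ₁ κ₂ r →
        θK⁻¹ * ρ = (HeckeCharacter.galConj c ψ)⁻¹ →
      ∀ (Sθ : Finset (HeightOneSpectrum (𝓞 K))), v ∉ Sθ → vbar ∉ Sθ →
        (∀ w ∈ Sθ, ¬ θK.IsUnramifiedAt w) →
        (∀ w : HeightOneSpectrum (𝓞 K), w ∉ Sθ → w ≠ v → w ≠ vbar → θK.IsUnramifiedAt w) →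
        (∃ σ ∈ ZpExtension.pairKer κ₁ κ₂, θ σ ≠ 1) ∧
        (∃ (W' : WeierstrassCurve ℚ) (_ : W'.IsElliptic) (_ : W'.IsGloballyMinimal) (ψ' ρ' : HeckeCharacter K)
            (r' r'' : FramedGaloisRep K (PadicAlgCl 2) 1),
          W'.j ∈ maximalCMJInvariants ∧ IsCMFieldOfJ K W'.j ∧ CMSplit W' 2 ∧
          W'.HasGoodReductionAtPrime 2 ∧ ¬ (2 : ℤ) ∣ W'.frobeniusTrace 2 ∧
          (ψ'.HasInfinityType (fun _ ↦ 1) (fun _ ↦ 0) ∨ ψ'.HasInfinityType (fun _ ↦ 0) (fun _ ↦ 1)) ∧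
          (∀ s : ℂ, 3 / 2 < s.re → heckeLFunction ψ' s = W'.LSeries s) ∧ IsPAdicAvatarOf ι ψ' r' ∧
          (∃ χ' : absoluteGaloisGroup K →ₜ* ℤ_[2]ˣ, ∀ σ : absoluteGaloisGroup K,
            ((((χ' σ : ℤ_[2]ˣ) : ℤ_[2]) : ℚ_[2]) : ℂ_[2]) = avatarValueAt r' σ) ∧
          (∀ w : HeightOneSpectrum (𝓞 K), w ∈ Sθ ↔ ¬ ψ'.IsUnramifiedAt w) ∧
          (∀ υ : absoluteGaloisGroup K, υ ∈ ZpExtension.pairKer κ₁ κ₂ →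
            ((((KellerYin2024.unitChar θ υ : ℤ_[2]ˣ) : ℤ_[2]) : ℚ_[2]) : ℂ_[2]) = avatarValueAt r' υ) ∧
          ψ'⁻¹ * ρ' = θK⁻¹ ∧ IsPAdicAvatarOf ι ρ' r'' ∧ FactorsThroughPair κ₁ κ₂ r'' ∧
          (∀ w : HeightOneSpectrum (𝓞 K), ((2 : ℕ) : 𝓞 K) ∉ w.asIdeal → ρ'.IsUnramifiedAt w) ∧
          (∀ σ : absoluteGaloisGroup K, avatarValueAt r'' σ =
            avatarValueAt r' σ * ((((KellerYin2024.unitChar θ σ : ℤ_[2]ˣ) : ℤ_[2]) : ℚ_[2]) : ℂ_[2]))))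
    (h3a :
      ∀ (K : Type) [Field K] [NumberField K], IsImaginaryQuadratic K →
      ¬ 2 ∣ NumberField.classNumber K →
      -- v13.5 (R-DA7): THE class field of the cm7 twists, `K = ℚ(√−7)`
      NumberField.discr K = -7 →
      ∀ (ι : PadicAlgCl 2 ≃+* ℂ) (v vbar : HeightOneSpectrum (𝓞 K)),
        ((2 : ℕ) : 𝓞 K) ∈ v.asIdeal → ((2 : ℕ) : 𝓞 K) ∈ vbar.asIdeal → vbar ≠ v →
        (∀ (w : InfinitePlace K) (k : 𝓞 K), k ∈ v.asIdeal ↔ ‖ι.symm (w.embedding (k : K))‖ < 1) →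
      ∃ (Ω δ : ℂ) (Ωp : (unrIntegers 2)ˣ), Ω ≠ 0 ∧
        (δ ^ 2 = (NumberField.discr K : ℂ) ∨ δ ^ 2 = -(NumberField.discr K : ℂ)) ∧
      ∀ (κ₁ κ₂ : ZpExtension K 2) (γ₁ γ₂ : absoluteGaloisGroup K),
        ZpExtension.IsTopGeneratorPair κ₁ κ₂ γ₁ γ₂ → κ₂.IsUnramifiedOutside vbar →
        -- v13.4 (R-DA): DOUBLY adapted — the first coordinate is THE `v`-line, the dual basis sits in the inertia groups
        κ₁.IsUnramifiedOutside v → γ₁ ∈ GreenbergSelmer.inertia v → γ₂ ∈ GreenbergSelmer.inertia vbar →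
      ∀ (θ : FramedGaloisRep K (padicCoeffIntegers (∅ : Set (PadicAlgCl 2))) 1),
        (∀ σ : absoluteGaloisGroup K, θ σ ^ 2 = 1) →
      ∀ (θK : HeckeCharacter K), KellerYin2024.IsHeckeCharOf ι θ θK →
      ∀ (S : Finset (HeightOneSpectrum (𝓞 K))), v ∉ S → vbar ∉ S →
        (∀ w ∈ S, ¬ θK.IsUnramifiedAt w) →
        (∀ w : HeightOneSpectrum (𝓞 K), w ∉ S → w ≠ v → w ≠ vbar → θK.IsUnramifiedAt w) →
        -- v14 (R-CLASS, LEAD g15): θ NON-trivial on the `v`-line, and the GOOD-TWIST DICTIONARY — a good ORDINARY member `W'` of the cm7 class over `K`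
        -- (CM by `𝓞_K`, good at `2`, `2 ∤ a₂`), its type-(1,0) character `ψ'` (Deuring) with `ι`-adic avatar `r'` whose SIGN on `Gal(K̄/K̃_∞)` is `θ`,
        -- whose ramification is `θ_K`'s exact tame set, and whose quotient `ρ' = θ_K·ψ'⁻¹` is a character through the pair (the measure dictionary
        -- `θ_K⁻¹ = ψ'⁻¹·ρ'`) — exactly the data the typed print `LiTianYanZhu2025.thm72_…` (Yager at `p = 2`) is stated for
        (∃ σ ∈ ZpExtension.pairKer κ₁ κ₂, θ σ ≠ 1) →
        (∃ (W' : WeierstrassCurve ℚ) (_ : W'.IsElliptic) (_ : W'.IsGloballyMinimal) (ψ' ρ' : HeckeCharacter K)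
            (r' r'' : FramedGaloisRep K (PadicAlgCl 2) 1),
          W'.j ∈ maximalCMJInvariants ∧ IsCMFieldOfJ K W'.j ∧ CMSplit W' 2 ∧
          W'.HasGoodReductionAtPrime 2 ∧ ¬ (2 : ℤ) ∣ W'.frobeniusTrace 2 ∧
          (ψ'.HasInfinityType (fun _ ↦ 1) (fun _ ↦ 0) ∨ ψ'.HasInfinityType (fun _ ↦ 0) (fun _ ↦ 1)) ∧
          (∀ s : ℂ, 3 / 2 < s.re → heckeLFunction ψ' s = W'.LSeries s) ∧ IsPAdicAvatarOf ι ψ' r' ∧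
          (∃ χ' : absoluteGaloisGroup K →ₜ* ℤ_[2]ˣ, ∀ σ : absoluteGaloisGroup K,
            ((((χ' σ : ℤ_[2]ˣ) : ℤ_[2]) : ℚ_[2]) : ℂ_[2]) = avatarValueAt r' σ) ∧
          (∀ w : HeightOneSpectrum (𝓞 K), w ∈ S ↔ ¬ ψ'.IsUnramifiedAt w) ∧
          (∀ υ : absoluteGaloisGroup K, υ ∈ ZpExtension.pairKer κ₁ κ₂ →
            ((((KellerYin2024.unitChar θ υ : ℤ_[2]ˣ) : ℤ_[2]) : ℚ_[2]) : ℂ_[2]) = avatarValueAt r' υ) ∧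
          ψ'⁻¹ * ρ' = θK⁻¹ ∧ IsPAdicAvatarOf ι ρ' r'' ∧ FactorsThroughPair κ₁ κ₂ r'' ∧
          (∀ w : HeightOneSpectrum (𝓞 K), ((2 : ℕ) : 𝓞 K) ∉ w.asIdeal → ρ'.IsUnramifiedAt w) ∧
          (∀ σ : absoluteGaloisGroup K, avatarValueAt r'' σ =
            avatarValueAt r' σ * ((((KellerYin2024.unitChar θ σ : ℤ_[2]ˣ) : ℤ_[2]) : ℚ_[2]) : ℂ_[2]))) →
      ∃ G₂ : PowerSeries (PowerSeries (PadicComplexInt 2)),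
        IsKatzMeasure₂₀ ι v vbar S κ₁ κ₂ γ₁⁻¹ γ₂⁻¹ θK⁻¹ Ω δ ((Ωp : unrIntegers 2) : ℂ_[2]) G₂ ∧
        ∀ D : DualData₂ κ₁ κ₂ (KellerYin2024.charModule (∅ : Set (PadicAlgCl 2)) θ) vbar γ₁ γ₂,
          Module.Finite (IwasawaAlgebra₂ 2) D.X ∧ Module.IsTorsion (IwasawaAlgebra₂ 2) D.X ∧
          ∀ (J : ℤ_[2] →+* PadicComplexInt 2),
            (∀ x : ℤ_[2], ((J x : PadicComplexInt 2) : ℂ_[2]) = ((x : ℚ_[2]) : ℂ_[2])) →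
            (Module.charIdeal (IwasawaAlgebra₂ 2) D.X).map
                (PowerSeries.map (PowerSeries.map J)) = Ideal.span {G₂} )
    (h2 : ∃ eA : ℤ → ℤ → ℤ,
      ∀ (d : ℤ), d ≠ 0 → Squarefree d → d % 4 ≠ 1 →
      ∀ (W : WeierstrassCurve ℚ) [W.IsElliptic] [W.IsGloballyMinimal] (C : VariableChange ℚ),
        C • W = cm7.quadraticTwist (d : ℚ) → W.analyticRank = 1 →
      ∀ (K : Type) [Field K] [NumberField K], IsImaginaryQuadratic K →
      ∀ (v vbar : HeightOneSpectrum (𝓞 K)),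
        ((2 : ℕ) : 𝓞 K) ∈ v.asIdeal → ((2 : ℕ) : 𝓞 K) ∈ vbar.asIdeal → vbar ≠ v →
      ∀ (ι : PadicAlgCl 2 ≃+* ℂ),
        (∀ (w : InfinitePlace K) (k : 𝓞 K), k ∈ v.asIdeal ↔ ‖ι.symm (w.embedding (k : K))‖ < 1) →
      ∀ (c : K ≃ₐ[ℚ] K), c ≠ 1 →
      ∀ (ψ : HeckeCharacter K), ψ.HasInfinityType (fun _ ↦ 1) (fun _ ↦ 0) →
        (∀ s : ℂ, 3 / 2 < s.re → heckeLFunction ψ s = W.LSeries s) →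
      ∀ (κ₁ κ₂ : ZpExtension K 2) (γ₁ γ₂ : absoluteGaloisGroup K), ZpExtension.IsTopGeneratorPair κ₁ κ₂ γ₁ γ₂ →
        κ₂.IsUnramifiedOutside vbar →
      ∀ (θ : FramedGaloisRep K (padicCoeffIntegers (∅ : Set (PadicAlgCl 2))) 1)
        (θK ρ : HeckeCharacter K) (r : FramedGaloisRep K (PadicAlgCl 2) 1),
        (∀ σ : absoluteGaloisGroup K, θ σ ^ 2 = 1) → KellerYin2024.IsHeckeCharOf ι θ θK →
        θK * θK = 1 → IsPAdicAvatarOf ι ρ r → FactorsThroughPair κ₁ κ₂ r →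
        θK⁻¹ * ρ = (HeckeCharacter.galConj c ψ)⁻¹ →
      ∀ (Sθ : Finset (HeightOneSpectrum (𝓞 K))), v ∉ Sθ → vbar ∉ Sθ →
        (∀ w ∈ Sθ, ¬ θK.IsUnramifiedAt w) →
        (∀ w : HeightOneSpectrum (𝓞 K), w ∉ Sθ → w ≠ v → w ≠ vbar → θK.IsUnramifiedAt w) →
      ∀ (Ω δ : ℂ) (Ωp : (unrIntegers 2)ˣ) (G₂ : PowerSeries (PowerSeries (PadicComplexInt 2))),
        Ω ≠ 0 → (δ ^ 2 = (NumberField.discr K : ℂ) ∨ δ ^ 2 = -(NumberField.discr K : ℂ)) →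
        IsKatzMeasure₂₀ ι v vbar Sθ κ₁ κ₂ γ₁⁻¹ γ₂⁻¹ θK⁻¹ Ω δ ((Ωp : unrIntegers 2) : ℂ_[2]) G₂ →
        -- v11: S3a's main-conjecture clause FOR THIS `G₂` (the frame's own measure; kills the period-rigidity exposure (R))
        (∀ D₂ : DualData₂ κ₁ κ₂ (KellerYin2024.charModule (∅ : Set (PadicAlgCl 2)) θ) vbar γ₁ γ₂,
          Module.Finite (IwasawaAlgebra₂ 2) D₂.X ∧ Module.IsTorsion (IwasawaAlgebra₂ 2) D₂.X ∧
          ∀ (J : ℤ_[2] →+* PadicComplexInt 2),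
            (∀ x : ℤ_[2], ((J x : PadicComplexInt 2) : ℂ_[2]) = ((x : ℚ_[2]) : ℂ_[2])) →
            (Module.charIdeal (IwasawaAlgebra₂ 2) D₂.X).map
                (PowerSeries.map (PowerSeries.map J)) = Ideal.span {G₂}) →
      ∀ (P : W.toAffine.Point) (c₀ : ℕ) (ℓ : ℤ),
        ¬ IsOfFinAddOrder P →
        (∀ R : W.toAffine.Point, ∃ (k : ℤ) (T : W.toAffine.Point), IsOfFinAddOrder T ∧ R = k • P + T) →
        c₀ ≠ 0 → (W.baseChange ℚ_[2]).IsInReductionKernel (c₀ • W.toPadicPoint 2 P) →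
        ‖(W.baseChange ℚ_[2]).padicLogPoint (c₀ • W.toPadicPoint 2 P) / (c₀ : ℚ_[2])‖ = (2 : ℝ) ^ (-ℓ) →
      ∃ q : ℚ, shaAn W = (q : ℂ) ∧
        ∀ (val : ℂ_[2]) (m : ℤ),
          IntSeries.HasValueAt₂ G₂ (avatarValueAt r γ₁⁻¹ - 1) (avatarValueAt r γ₂⁻¹ - 1) val →
          ‖val‖ = (2 : ℝ) ^ (-(m : ℝ) / 2) →
          m = 2 * (padicValRat 2 q + (padicValNat 2 W.tamagawaProduct : ℤ)
                - 2 * (padicValNat 2 W.torsionOrder : ℤ) + 2 * ℓ) + eA (d % 2) ((d / (2 - d % 2)) % 8))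
    (h3 : ∃ eB : ℤ → ℤ → ℤ,
      ∀ (d : ℤ), d ≠ 0 → Squarefree d → d % 4 ≠ 1 →
      ∀ (W : WeierstrassCurve ℚ) [W.IsElliptic] [W.IsGloballyMinimal] (C : VariableChange ℚ),
        C • W = cm7.quadraticTwist (d : ℚ) → W.analyticRank = 1 →
        Finite W.sha →
      ∀ (K : Type) [Field K] [NumberField K], IsImaginaryQuadratic K →
      ∀ (v vbar : HeightOneSpectrum (𝓞 K)),
        ((2 : ℕ) : 𝓞 K) ∈ v.asIdeal → ((2 : ℕ) : 𝓞 K) ∈ vbar.asIdeal → vbar ≠ v →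
      ∀ (ι : PadicAlgCl 2 ≃+* ℂ),
        (∀ (w : InfinitePlace K) (k : 𝓞 K), k ∈ v.asIdeal ↔ ‖ι.symm (w.embedding (k : K))‖ < 1) →
      ∀ (c : K ≃ₐ[ℚ] K), c ≠ 1 →
      ∀ (ψ : HeckeCharacter K), ψ.HasInfinityType (fun _ ↦ 1) (fun _ ↦ 0) →
        (∀ s : ℂ, 3 / 2 < s.re → heckeLFunction ψ s = W.LSeries s) →
      ∀ (κ₁ κ₂ : ZpExtension K 2) (γ₁ γ₂ : absoluteGaloisGroup K), ZpExtension.IsTopGeneratorPair κ₁ κ₂ γ₁ γ₂ →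
        κ₂.IsUnramifiedOutside vbar →
      ∀ (θ : FramedGaloisRep K (padicCoeffIntegers (∅ : Set (PadicAlgCl 2))) 1)
        (θK ρ : HeckeCharacter K) (r : FramedGaloisRep K (PadicAlgCl 2) 1),
        (∀ σ : absoluteGaloisGroup K, θ σ ^ 2 = 1) → KellerYin2024.IsHeckeCharOf ι θ θK →
        θK * θK = 1 → IsPAdicAvatarOf ι ρ r → FactorsThroughPair κ₁ κ₂ r →
        θK⁻¹ * ρ = (HeckeCharacter.galConj c ψ)⁻¹ →
      ∀ (Sθ : Finset (HeightOneSpectrum (𝓞 K))), v ∉ Sθ → vbar ∉ Sθ →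
        (∀ w ∈ Sθ, ¬ θK.IsUnramifiedAt w) →
        (∀ w : HeightOneSpectrum (𝓞 K), w ∉ Sθ → w ≠ v → w ≠ vbar → θK.IsUnramifiedAt w) →
      ∀ (Ω δ : ℂ) (Ωp : (unrIntegers 2)ˣ) (G₂ : PowerSeries (PowerSeries (PadicComplexInt 2))),
        Ω ≠ 0 → (δ ^ 2 = (NumberField.discr K : ℂ) ∨ δ ^ 2 = -(NumberField.discr K : ℂ)) →
        IsKatzMeasure₂₀ ι v vbar Sθ κ₁ κ₂ γ₁⁻¹ γ₂⁻¹ θK⁻¹ Ω δ ((Ωp : unrIntegers 2) : ℂ_[2]) G₂ →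
        -- v11: S3a's main-conjecture clause FOR THIS `G₂` (the frame's own measure; kills the period-rigidity exposure (R))
        (∀ D₂ : DualData₂ κ₁ κ₂ (KellerYin2024.charModule (∅ : Set (PadicAlgCl 2)) θ) vbar γ₁ γ₂,
          Module.Finite (IwasawaAlgebra₂ 2) D₂.X ∧ Module.IsTorsion (IwasawaAlgebra₂ 2) D₂.X ∧
          ∀ (J : ℤ_[2] →+* PadicComplexInt 2),
            (∀ x : ℤ_[2], ((J x : PadicComplexInt 2) : ℂ_[2]) = ((x : ℚ_[2]) : ℂ_[2])) →
            (Module.charIdeal (IwasawaAlgebra₂ 2) D₂.X).map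
                (PowerSeries.map (PowerSeries.map J)) = Ideal.span {G₂}) →
      ∀ (P : W.toAffine.Point) (c₀ : ℕ) (ℓ : ℤ),
        ¬ IsOfFinAddOrder P →
        (∀ R : W.toAffine.Point, ∃ (k : ℤ) (T : W.toAffine.Point), IsOfFinAddOrder T ∧ R = k • P + T) →
        c₀ ≠ 0 → (W.baseChange ℚ_[2]).IsInReductionKernel (c₀ • W.toPadicPoint 2 P) →
        ‖(W.baseChange ℚ_[2]).padicLogPoint (c₀ • W.toPadicPoint 2 P) / (c₀ : ℚ_[2])‖ = (2 : ℝ) ^ (-ℓ) →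
      ∃ m : ℤ, (∀ val : ℂ_[2],
          IntSeries.HasValueAt₂ G₂ (avatarValueAt r γ₁⁻¹ - 1) (avatarValueAt r γ₂⁻¹ - 1) val →
          ‖val‖ = (2 : ℝ) ^ (-(m : ℝ) / 2)) ∧
        m = 2 * ((padicValNat 2 (Nat.card (AddCommGroup.primaryComponent W.sha 2)) : ℤ)
              + (padicValNat 2 W.tamagawaProduct : ℤ)
              - 2 * (padicValNat 2 W.torsionOrder : ℤ) + 2 * ℓ) + eB (d % 2) ((d / (2 - d % 2)) % 8)) :
    ∃ e : ℤ → ℤ → ℤ,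
      ∀ (d : ℤ), d ≠ 0 → Squarefree d → d % 4 ≠ 1 →
      ∀ (W : WeierstrassCurve ℚ) [W.IsElliptic] [W.IsGloballyMinimal] (C : VariableChange ℚ),
        C • W = cm7.quadraticTwist (d : ℚ) → W.analyticRank = 1 →
      ∃ q : ℚ, shaAn W = (q : ℂ) ∧
        padicValRat 2 q = (padicValNat 2 (Nat.card (AddCommGroup.primaryComponent W.sha 2)) : ℤ)
          + e (d % 2) ((d / (2 - d % 2)) % 8) := by
  obtain ⟨eA, hA⟩ := h2
  obtain ⟨eB, hBB⟩ := h3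
  refine ⟨fun a b ↦ (eB a b - eA a b) / 2, ?_⟩
  intro d hd0 hsq hd4 W _ _ C hC hr
  obtain ⟨K, iF, iN, v, vbar, ι, cc, ψ, κ₁, κ₂, γ₁, γ₂, θ, θK, ρ, r, Sθ, P, c₀, ℓ, hK, h2K, hdK, hv, hvbar, hne, hι, hcc, hψ, hL,
    hpair, hκ₂, hκ₁, hγ₁, hγ₂, hθ2, hθθK, hθK, hρr, hrpair, hρ, hvS, hvbarS, hSram, hSunr, hval, hP, hgen, hc₀, hker, hlog, hsha, hθne, hdict⟩ :=
    RubinValueTwoIngredientsV15FrameD.frameSupply_two_v15d_of_dict hdictAll hGZK hdeu d hd0 hsq hd4 W C hC hr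
  obtain ⟨Ω, δ, Ωp, hΩ, hδ, hmeas⟩ := h3a K hK h2K hdK ι v vbar hv hvbar hne hι
  obtain ⟨G₂, hG₂, hMC⟩ := hmeas κ₁ κ₂ γ₁ γ₂ hpair hκ₂ hκ₁ hγ₁ hγ₂ θ hθ2 θK hθθK Sθ hvS hvbarS hSram hSunr hθne hdict
  obtain ⟨val, hvalG⟩ := hval G₂
  obtain ⟨q, hq, hAq⟩ := hA d hd0 hsq hd4 W C hC hr K hK v vbar hv hvbar hne ι hι cc hcc ψ hψ hL κ₁ κ₂ γ₁ γ₂ hpair hκ₂ θ θK ρ r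
    hθ2 hθθK hθK hρr hrpair hρ Sθ hvS hvbarS hSram hSunr Ω δ Ωp G₂ hΩ hδ hG₂ hMC P c₀ ℓ hP hgen hc₀ hker hlog
  obtain ⟨m, hm, hBm⟩ := hBB d hd0 hsq hd4 W C hC hr hsha K hK v vbar hv hvbar hne ι hι cc hcc ψ hψ hL κ₁ κ₂ γ₁ γ₂ hpair hκ₂ θ θK ρ r
    hθ2 hθθK hθK hρr hrpair hρ Sθ hvS hvbarS hSram hSunr Ω δ Ωp G₂ hΩ hδ hG₂ hMC P c₀ ℓ hP hgen hc₀ hker hlog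
  have hAm := hAq val m hvalG (hm val hvalG)
  refine ⟨q, hq, ?_⟩
  dsimp only
  omega

end Summit.BirchSwinnertonDyer.BirchSwinnertonDyer.Theorems.PrintCf2.RubinValueTwoIngredientsV16

end
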